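import Mathlib
import Literature.Combinatorics.Optimization.MatchingJunta
import HarnessLib

/-!
# The symmetric pseudo-matching functional of `K_N` (`N` odd) — Potechin's "story" pseudo-expectation
# for the MOD 2 principle. Part A: definitions, the symmetry reduction, the outcome decomposition

Source: A. Potechin, *Sum of squares lower bounds from symmetry and a good story*, ITCS 2019,
LIPIcs 124, 61:1–61:20; arXiv:1711.11469 (held: `paper:arxiv-1711.11469`; page locators "p. n" below
are arXiv pages, "61:n" are LIPIcs pages) [Potechin2019].  Sibling of `Mod2SosDegree.lean`
(Grigoriev's Tseitin-route degree bound `Grigoriev2001_mod2Degree_holds`, which does not treat the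
symmetric functional) and of `KnapsackSosDegree.lean` (the knapsack story).

## What is printed (verbatim up to notation)

* The MOD 2 equations (p. 3, 61:3): variables `x_{ij}` (`i < j`), "`x_{ij}² − x_{ij} = 0`" and
  "for all `i`, `Σ_{j ≠ i} x_{ij} − 1 = 0`"; infeasible for odd `n`.
* **Theorem 1.2** (p. 4, 61:4): "Degree `(n−1)/2` SOS fails to prove that the equations for the MOD 2
  principle are infeasible."  **Corollary 3.10** (p. 9, 61:9): "For all positive odd integers `n`,
  index degree `n` SOS fails to refute the equations for the MOD 2 principle."
* **Definition 2.14** (p. 6, 61:6): index degree `d` pseudo-expectation values = a linear `Ẽ` on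
  polynomials of index degree `≤ d` with `Ẽ[1] = 1`, `Ẽ[f s_i] = 0` (`indexdeg f + indexdeg s_i ≤ d`),
  `Ẽ[g²] ≥ 0` (`indexdeg g ≤ d/2`); Remark 2.16: the last condition says the moment matrix
  `M_{pq} = Ẽ[pq]` on monomials of index degree `≤ d/2` is PSD.
* **Example 3.4** (p. 7, 61:7), the story values: "for all `E ⊆ {(i,j)}` …
  `Ẽ[∏_{(i,j) ∈ E} x_{ij}] = 1/∏_{j=1}^{|E|} (n − 2j + 1)` if `E` is a partial matching and
  `Ẽ[∏_{(i,j)∈E} x_{ij}] = 0` otherwise" — `storyValue` below (`moment N ℓ = ∏_{j<ℓ}(N−1−2j)⁻¹`).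

A partial matching with `ℓ` edges has index degree `2ℓ`, and non-matching monomials pair to `0`
with everything, so Theorem 1.2 / Cor. 3.10 say: for odd `N` the moment matrix
`(Ẽ[x_{A∪B}])` on edge sets `A, B` with `≤ k` edges is PSD whenever `4k + 1 ≤ N` — the form
`storyForm N k` below is non-negative.  This is the hypothesis `hU`/`hUc` of the kernel theorem
`Summit.PneNP…ChebyshevTracialDesignPseudoMatchingTensor.sum_levelWeight_trace_nonpos_of_lowDegreeM_of_clique_forms`
(cell pnp-psdrank, stmt-PneNP-19878), for the cliques `K_t`, `K_{n−t}` of an odd cut.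

## What this development proves, and a caveat on the printed proof

Parts A (this file), B (`…Honest.lean`), C (`…Interpolation.lean`) prove, with no named facts,
`storyForm N k δ ≥ 0` for odd `N` and **`6k ≤ N`** (index degree `≤ N/3`), which is the range the
printed argument supports: Potechin's proof (Thm 5.11, p. 12–13) decomposes `Ẽ[g²]` into squares of
polynomials `g_{Ij}` symmetric under `S_{[n]∖I}` (Thm 4.1, from Raymond–Saunderson–Singh–Thomas
Cor. 2.6) and conditions on the outcome inside `I` (Thm 5.12 (2)), which needs
`indexdeg_{[n]∖I}(g_{Ij}) ≤ (n − |I|)/2`; this is obtained from **Lemma 5.13** (p. 13: "all monomials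
in `g_{Ij}` depend on all of the indices in `I`"), which is false as stated — `g = x_1 − (n−1)⁻¹Σ_{j≥2} x_j`,
`I = {1}` (the paper's own `φ_{F,(i)}`, Ex. 8.17, p. 22) satisfies its hypotheses and not its
conclusion — and numerically (exact arithmetic, `N = 9`, `I = {0,1,2,3}`, `φ = φ_{F,L}` of Def. 8.15 for
two labelled edges) the per-outcome identity `Pr(F)·Ẽ[φ² 1_F] = Ẽ[φ 1_F]²` behind Thm 5.12 (2) fails,
with `Ẽ[φ² 1_F] < 0` for some outcomes although `Ẽ[φ²] > 0`.  Without Lemma 5.13 the off-`I` index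
degree of `g_{Ij}` is only `≤ indexdeg g`, and the argument closes exactly under the "fitting"
condition `|I| + t_A + t_B ≤ N` used below, i.e. for `6k ≤ N`.  The statement of Theorem 1.2 itself
(`4k + 1 ≤ N`) checks numerically for `N ≤ 11` (the `415 × 415` and `1046 × 1046` moment matrices at
`(N,k) = (9,2), (11,2)` are PSD; `(7,2)` is not) and is NOT contradicted here; it is simply not what the
printed proof establishes, so it is not vendored as a named fact (`-- TODO(general form)`: the tight
range `4k + 1 ≤ N` needs the representation theory of the perfect-matching scheme).  The consumer only
needs a linear range `k ≤ c₀ N`.  (Cell notes: pnp-psdrank `littype-FN2-1` g8.)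

## Contents of Part A

* §1 `moment`, §2 `IsPartialMatching`, `storyValue`, §3 `EdgeSets`, `storyForm`;
* §4 `qform_nonneg_of_invariant` — an elementary replacement for Thm 4.1: for a symmetric kernel
  invariant under a permutation action, non-negativity on vectors fixed by point stabilisers implies
  non-negativity (a negative eigenvector averaged over the stabiliser of a point of its support stays a
  non-zero eigenvector); §5 the relabelling action `relabel`, `edgeSetsPerm`, the pointwise stabilisers
  `stab I`, `verts`; §6 `storyForm_nonneg_of_invariant` (it suffices to treat coefficient vectors
  invariant under `stab I`, `|I| ≤ 2k`);
* §7 `outcomeValue N I F C = Ẽ[x_C 1_F]` (`1_F` = indicator that the matching inside `I` is exactly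
  `F`, expanded by inclusion–exclusion) and the partition of unity `Σ_{F ⊆ E(I)} Ẽ[x_C 1_F] = Ẽ[x_C]`
  (`sum_outcomeValue`) — the conditioning step of Thm 5.12 (2) / Def. 5.2.

## References

* A. Potechin, *Sum of squares lower bounds from symmetry and a good story*, ITCS 2019, LIPIcs 124,
  Thm 1.2, Def 2.14, Ex 3.4, Cor 3.10, Thm 4.1, Thm 5.11–5.12, Lemma 5.13, §6, App. 8. [Potechin2019]
* D. Grigoriev, *Linear lower bound on degrees of Positivstellensatz calculus proofs for the parity*,
  Theoret. Comput. Sci. 259 (2001) 613–622 (the original `Ω(n)` bound, via Tseitin). [Grigoriev2001TCS]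
-/

noncomputable section

open Finset Matrix
open scoped BigOperators

namespace Literature.Computability.Complexity

namespace PseudoMatching

/-! ### §1 The story moments -/

/-- **The story pseudo-moments** `μ_m(ℓ) = ∏_{j<ℓ} (m − 1 − 2j)⁻¹ = 1/((m−1)(m−3)⋯(m−2ℓ+1))`:
Potechin's value of `Ẽ[∏_{(i,j) ∈ E} x_{ij}]` for a partial matching `E` with `|E| = ℓ` edges
("`= 1/∏_{j=1}^{|E|}(n − 2j + 1)`"); for even `m` it is the probability that a uniformly random
perfect matching of `K_m` contains `ℓ` prescribed disjoint edges.
[cite: Potechin2019, Example 3.4 (LIPIcs 124, 61:7)] -/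
def moment (m ℓ : ℕ) : ℝ := ∏ j ∈ range ℓ, ((m : ℝ) - 1 - 2 * j)⁻¹

/-- `μ_m(0) = 1`. [cite: Potechin2019, Example 3.4 (61:7)] -/
@[simp] theorem moment_zero (m : ℕ) : moment m 0 = 1 := by simp [moment]

/-- `μ_m(ℓ+1) = μ_m(ℓ) · (m − 1 − 2ℓ)⁻¹`. [cite: Potechin2019, Example 3.4 (61:7)] -/
theorem moment_succ (m ℓ : ℕ) : moment m (ℓ + 1) = moment m ℓ * ((m : ℝ) - 1 - 2 * ℓ)⁻¹ := by
  rw [moment, moment, prod_range_succ]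

/-- The moments are positive as long as `2ℓ ≤ m`. [cite: Potechin2019, §3.2 (61:9, "non-negative probability")] -/
theorem moment_pos {m ℓ : ℕ} (h : 2 * ℓ ≤ m) : 0 < moment m ℓ := by
  unfold moment
  refine prod_pos fun j hj => inv_pos.2 ?_
  have hj' := mem_range.1 hj
  have : (2 : ℝ) * j ≤ (m : ℝ) - 2 := by
    have : (2 * j + 2 : ℕ) ≤ m := by omega
    have := (Nat.cast_le (α := ℝ)).2 this
    push_cast at this
    linarith
  linarith

/-- `μ_m(ℓ) = (∏_{j<ℓ} (m − 1 − 2j))⁻¹` (the form in which the consumer states it). [cite: Potechin2019, Example 3.4 (61:7)] -/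
theorem moment_eq_inv_prod (m ℓ : ℕ) :
    moment m ℓ = (∏ j ∈ range ℓ, ((m : ℝ) - 1 - 2 * j))⁻¹ := by
  rw [moment, prod_inv_distrib]

/-! ### §2 Partial matchings and the story value of a monomial -/

variable {N : ℕ}

/-- `G` is a **partial matching** of `K_N`: no loops and every vertex lies on at most one edge
of `G`. These index the non-zero story monomials. [cite: Potechin2019, Example 3.4 (61:7)] -/
def IsPartialMatching (G : Finset (Sym2 (Fin N))) : Prop :=
  (∀ e ∈ G, ¬ e.IsDiag) ∧ ∀ v : Fin N, (G.filter fun e => v ∈ e).card ≤ 1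

/-- **The story value of the monomial `x_G = ∏_{e ∈ G} x_e`**:
`Ẽ[x_G] = μ_N(|G|)` if `G` is a partial matching and `0` otherwise.
[cite: Potechin2019, Example 3.4 (LIPIcs 124, 61:7)] -/
def storyValue (N : ℕ) (G : Finset (Sym2 (Fin N))) : ℝ :=
  by classical exact if IsPartialMatching G then moment N G.card else 0

/-- Non-matchings have story value `0` ("`Ẽ[x_E] = 0` otherwise"). [cite: Potechin2019, Example 3.4 (61:7)] -/
theorem storyValue_of_not {G : Finset (Sym2 (Fin N))} (h : ¬ IsPartialMatching G) :
    storyValue N G = 0 := by classical simp [storyValue, h]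

/-- Partial matchings with `ℓ` edges have story value `μ_N(ℓ)`. [cite: Potechin2019, Example 3.4 (61:7)] -/
theorem storyValue_of {G : Finset (Sym2 (Fin N))} (h : IsPartialMatching G) :
    storyValue N G = moment N G.card := by classical simp [storyValue, h]

/-- `Ẽ[1] = 1` (the empty monomial). [cite: Potechin2019, Def. 2.14 (61:6)] -/
@[simp] theorem storyValue_empty (N : ℕ) : storyValue N (∅ : Finset (Sym2 (Fin N))) = 1 := by
  rw [storyValue_of ⟨by simp, by simp⟩, card_empty, moment_zero]

/-- Subsets of partial matchings are partial matchings. [cite: Potechin2019, Example 3.4 (61:7)] -/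
theorem IsPartialMatching.subset {G H : Finset (Sym2 (Fin N))} (hH : IsPartialMatching H) (hGH : G ⊆ H) :
    IsPartialMatching G :=
  ⟨fun e he => hH.1 e (hGH he), fun v => (card_le_card (filter_subset_filter _ hGH)).trans (hH.2 v)⟩

/-! ### §3 The moment form ("`Ẽ[g²]`" on multilinear `g` of edge-degree `≤ k`) -/

/-- Coefficient index set: edge sets of `K_N` with at most `k` edges (the monomials of a
multilinear polynomial of degree `≤ k` in the edge variables).
[cite: Potechin2019, Remark 2.16 (61:6, the moment matrix)] -/
abbrev EdgeSets (N k : ℕ) : Type := {A : Finset (Sym2 (Fin N)) // A.card ≤ k}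

/-- **The story moment form** `Ẽ[g²] = Σ_{A,B} δ_A δ_B Ẽ[x_{A ∪ B}]` of the multilinear polynomial
`g = Σ_A δ_A x_A` of edge-degree `≤ k` (multilinear reduction `x_A x_B = x_{A∪B}`, valid under `Ẽ`
since the story's `x_e` are `0/1`). Its non-negativity for all `δ` says that the moment matrix
`(Ẽ[x_{A∪B}])_{|A|,|B| ≤ k}` is positive semidefinite.
[cite: Potechin2019, Def. 2.14 and Remark 2.16 (61:6)] -/
def storyForm (N k : ℕ) (δ : EdgeSets N k → ℝ) : ℝ :=
  ∑ A, ∑ B, δ A * δ B * storyValue N (A.1 ∪ B.1)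

/-! ### §4 A symmetry reduction: it suffices to test vectors fixed by a point stabiliser

An elementary replacement for Potechin's Theorem 4.1 (Raymond–Saunderson–Singh–Thomas Cor. 2.6):
for a finite group acting on the index set of a symmetric invariant kernel, if the quadratic form is
non-negative on every vector fixed by one of a family of subgroups `S x₀` (each fixing its base
point `x₀`), then it is non-negative everywhere — a negative eigenvector, averaged over `S x₀` for a
point `x₀` of its support, stays a (non-zero, `S x₀`-invariant) eigenvector of the same eigenvalue. -/

section Reduction

variable {X : Type*} [Fintype X] [DecidableEq X] {G : Type*} [Group G]

/-- The quadratic form `Σ_{x,y} v_x v_y K(x,y)` of a kernel. [cite: Potechin2019, Remark 2.16 (61:6)] -/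
def qform (K : X → X → ℝ) (v : X → ℝ) : ℝ := ∑ x, ∑ y, v x * v y * K x y

omit [DecidableEq X] in
/-- The quadratic form as `vᵀ M v`. [cite: Potechin2019, Remark 2.16 (61:6)] -/
theorem qform_eq_dotProduct (K : X → X → ℝ) (v : X → ℝ) :
    qform K v = v ⬝ᵥ ((Matrix.of fun x y => K x y) *ᵥ v) := by
  simp only [qform, dotProduct, Matrix.mulVec, Matrix.of_apply, mul_sum]
  refine sum_congr rfl fun x _ => sum_congr rfl fun y _ => ?_
  ring

/-- **Symmetry reduction.** Let `ρ : G → Perm X` be an action by which the symmetric kernel `K`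
is invariant, and for each `x₀` let `S x₀ ⊆ G` be a finite subgroup (given as a `Finset` closed under
products and inverses) fixing `x₀`. If `Σ v_x v_y K(x,y) ≥ 0` for every `x₀` and every
`S x₀`-invariant `v`, then it holds for all `v`. (Proof: otherwise take an eigenvector `u` of the
kernel matrix with eigenvalue `λ < 0` and `x₀` with `u(x₀) ≠ 0`; `Σ_{g ∈ S x₀} u ∘ ρ(g)⁻¹` is again a
`λ`-eigenvector, is `S x₀`-invariant, and does not vanish at `x₀`.) [cite: Potechin2019, Theorem 4.1
(61:10) — the role it plays; this elementary form and its proof replace the representation theory] -/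
theorem qform_nonneg_of_invariant (ρ : G →* Equiv.Perm X) (K : X → X → ℝ)
    (hsymm : ∀ x y, K x y = K y x) (hinv : ∀ (g : G) (x y : X), K (ρ g x) (ρ g y) = K x y)
    (S : X → Finset G) (hone : ∀ x, (1 : G) ∈ S x) (hmul : ∀ x, ∀ g ∈ S x, ∀ h ∈ S x, g * h ∈ S x)
    (hinvmem : ∀ x, ∀ g ∈ S x, g⁻¹ ∈ S x) (hfix : ∀ x, ∀ g ∈ S x, ρ g x = x)
    (hpos : ∀ (x₀ : X) (v : X → ℝ), (∀ g ∈ S x₀, ∀ x, v (ρ g x) = v x) → 0 ≤ qform K v)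
    (v : X → ℝ) : 0 ≤ qform K v := by
  classical
  by_contra hneg
  push Not at hneg
  set M : Matrix X X ℝ := Matrix.of fun x y => K x y with hM_def
  have hM : M.IsHermitian := by
    ext x y; simp [hM_def, hsymm x y]
  -- `M` is not positive semidefinite, so it has a negative eigenvalue
  have hnot : ¬ M.PosSemidef := by
    intro hP
    have := (Matrix.posSemidef_iff_dotProduct_mulVec.mp hP).2 v
    rw [star_trivial, ← qform_eq_dotProduct] at this
    exact absurd this (not_le.2 hneg)
  rw [hM.posSemidef_iff_eigenvalues_nonneg] at hnot
  simp only [Pi.le_def, Pi.zero_apply, not_forall, not_le] at hnot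
  obtain ⟨i, hi⟩ := hnot
  set lam := hM.eigenvalues i with hlam
  set u : X → ℝ := ⇑(hM.eigenvectorBasis i) with hu_def
  have hMu : M *ᵥ u = lam • u := hM.mulVec_eigenvectorBasis i
  have hu0 : u ≠ 0 := by
    have h1 : ‖hM.eigenvectorBasis i‖ = 1 := hM.eigenvectorBasis.orthonormal.1 i
    intro h
    have : (hM.eigenvectorBasis i) = 0 := by
      apply PiLp.ext; intro x; exact congr_fun h x
    rw [this, norm_zero] at h1
    exact zero_ne_one h1
  obtain ⟨x₀, hx₀⟩ := Function.ne_iff.1 hu0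
  -- average `u` over `S x₀`
  set w : X → ℝ := fun x => ∑ g ∈ S x₀, u (ρ g⁻¹ x) with hw_def
  -- each translate is a `lam`-eigenvector
  have hMg : ∀ (g : G) (x : X), (M *ᵥ fun y => u (ρ g⁻¹ y)) x = lam * u (ρ g⁻¹ x) := by
    intro g x
    have hx := congr_fun hMu (ρ g⁻¹ x)
    simp only [Pi.smul_apply, smul_eq_mul] at hx
    rw [← hx]
    simp only [Matrix.mulVec, dotProduct, hM_def, Matrix.of_apply]
    refine Fintype.sum_equiv (ρ g⁻¹) _ _ fun y => ?_
    rw [hinv g⁻¹ x y]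
  have hMw : M *ᵥ w = lam • w := by
    funext x
    simp only [Pi.smul_apply, smul_eq_mul, hw_def]
    have : (M *ᵥ fun x => ∑ g ∈ S x₀, u (ρ g⁻¹ x)) x
        = ∑ g ∈ S x₀, (M *ᵥ fun y => u (ρ g⁻¹ y)) x := by
      simp only [Matrix.mulVec, dotProduct, mul_sum]
      rw [sum_comm]
    rw [this, mul_sum]
    exact sum_congr rfl fun g _ => hMg g x
  -- `w x₀ ≠ 0`
  have hwx₀ : w x₀ ≠ 0 := by
    have : w x₀ = ∑ _g ∈ S x₀, u x₀ := by
      simp only [hw_def]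
      refine sum_congr rfl fun g hg => ?_
      have h1 : ρ g⁻¹ x₀ = x₀ := hfix x₀ g⁻¹ (hinvmem x₀ g hg)
      rw [h1]
    rw [this, sum_const, nsmul_eq_mul]
    refine mul_ne_zero ?_ hx₀
    have : 0 < (S x₀).card := card_pos.2 ⟨1, hone x₀⟩
    exact_mod_cast this.ne'
  -- `w` is `S x₀`-invariant
  have hwinv : ∀ h ∈ S x₀, ∀ x : X, w (ρ h x) = w x := by
    intro h hh x
    simp only [hw_def]
    refine sum_nbij' (fun g => h⁻¹ * g) (fun g => h * g) (fun g hg => hmul x₀ _ (hinvmem x₀ h hh) _ hg)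
      (fun g hg => hmul x₀ _ hh _ hg) (fun g _ => by group) (fun g _ => by group) fun g _ => ?_
    rw [_root_.mul_inv_rev, inv_inv, map_mul, Equiv.Perm.mul_apply]
  -- the form at `w` is `lam * ‖w‖² < 0`
  have hform : qform K w = lam * ∑ x, w x * w x := by
    rw [qform_eq_dotProduct, ← hM_def, hMw]
    simp only [dotProduct, Pi.smul_apply, smul_eq_mul, mul_sum]
    exact sum_congr rfl fun x _ => by ring
  have hsq : 0 < ∑ x, w x * w x := by
    refine lt_of_lt_of_le (mul_self_pos.2 hwx₀) ?_
    exact single_le_sum (f := fun x => w x * w x) (fun x _ => mul_self_nonneg (w x)) (mem_univ x₀)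
  have hneg' : qform K w < 0 := by rw [hform]; exact mul_neg_of_neg_of_pos hi hsq
  exact absurd (hpos x₀ w hwinv) (not_le.2 hneg')

end Reduction

/-! ### §5 Relabelling by vertex permutations -/

/-- Relabelling of pairs by a vertex permutation, as an embedding of `Sym2 (Fin N)`. [cite: Potechin2019, §4 (61:10)] -/
def edgeMap (σ : Equiv.Perm (Fin N)) : Sym2 (Fin N) ↪ Sym2 (Fin N) := σ.toEmbedding.sym2Map

/-- Unfolding. [cite: Potechin2019, §4 (61:10)] -/
@[simp] theorem edgeMap_apply (σ : Equiv.Perm (Fin N)) (e : Sym2 (Fin N)) : edgeMap σ e = Sym2.map σ e := rfl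

/-- Relabelling of an edge set: `σ · A = {σ(e) : e ∈ A}`. [cite: Potechin2019, §4 (61:10, "symmetric under permutations of [1,n]")] -/
def relabel (σ : Equiv.Perm (Fin N)) (A : Finset (Sym2 (Fin N))) : Finset (Sym2 (Fin N)) := A.map (edgeMap σ)

/-- Membership in a relabelled edge set. [cite: Potechin2019, §4 (61:10)] -/
theorem mem_relabel {σ : Equiv.Perm (Fin N)} {A : Finset (Sym2 (Fin N))} {e : Sym2 (Fin N)} :
    e ∈ relabel σ A ↔ ∃ e' ∈ A, Sym2.map σ e' = e := by
  simp [relabel]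

/-- Relabelling preserves the number of edges. [cite: Potechin2019, §4 (61:10)] -/
@[simp] theorem card_relabel (σ : Equiv.Perm (Fin N)) (A : Finset (Sym2 (Fin N))) :
    (relabel σ A).card = A.card := card_map _

/-- The identity relabelling. [cite: Potechin2019, §4 (61:10)] -/
@[simp] theorem relabel_one (A : Finset (Sym2 (Fin N))) : relabel 1 A = A := by
  ext e; simp [mem_relabel]

/-- Relabelling is an action. [cite: Potechin2019, §4 (61:10)] -/
theorem relabel_mul (σ τ : Equiv.Perm (Fin N)) (A : Finset (Sym2 (Fin N))) :
    relabel (σ * τ) A = relabel σ (relabel τ A) := by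
  rw [relabel, relabel, relabel, Finset.map_map]
  congr 1
  ext e : 1
  simp only [Function.Embedding.trans_apply, edgeMap_apply, Equiv.Perm.coe_mul, Sym2.map_map]

/-- Relabelling commutes with unions (`σ(x_A x_B) = σ(x_A)σ(x_B)`). [cite: Potechin2019, §4 (61:10)] -/
theorem relabel_union (σ : Equiv.Perm (Fin N)) (A B : Finset (Sym2 (Fin N))) :
    relabel σ (A ∪ B) = relabel σ A ∪ relabel σ B := map_union _ _

/-- `σ⁻¹ · σ · A = A`. [cite: Potechin2019, §4 (61:10)] -/
theorem relabel_inv_relabel (σ : Equiv.Perm (Fin N)) (A : Finset (Sym2 (Fin N))) :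
    relabel σ⁻¹ (relabel σ A) = A := by rw [← relabel_mul, inv_mul_cancel, relabel_one]

/-- `σ · σ⁻¹ · A = A`. [cite: Potechin2019, §4 (61:10)] -/
theorem relabel_relabel_inv (σ : Equiv.Perm (Fin N)) (A : Finset (Sym2 (Fin N))) :
    relabel σ (relabel σ⁻¹ A) = A := by rw [← relabel_mul, mul_inv_cancel, relabel_one]

/-- The edges of `σ · G` at `σ v` are the relabelled edges of `G` at `v`. [cite: Potechin2019, §4 (61:10)] -/
theorem filter_mem_relabel (σ : Equiv.Perm (Fin N)) (G : Finset (Sym2 (Fin N))) (v : Fin N) :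
    (relabel σ G).filter (fun e => σ v ∈ e) = relabel σ (G.filter fun e => v ∈ e) := by
  simp only [relabel, filter_map]
  congr 1
  refine filter_congr fun e _ => ?_
  simp only [Function.comp_apply, edgeMap_apply, Sym2.mem_map]
  constructor
  · rintro ⟨w, hw, hwv⟩; rwa [← σ.injective hwv]
  · exact fun h => ⟨v, h, rfl⟩

/-- Relabelling preserves partial matchings. [cite: Potechin2019, §4 (61:10)] -/
theorem isPartialMatching_relabel {σ : Equiv.Perm (Fin N)} {G : Finset (Sym2 (Fin N))} :
    IsPartialMatching (relabel σ G) ↔ IsPartialMatching G := by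
  suffices h : ∀ (σ : Equiv.Perm (Fin N)) (G : Finset (Sym2 (Fin N))),
      IsPartialMatching G → IsPartialMatching (relabel σ G) by
    refine ⟨fun hG => ?_, h σ G⟩
    have := h σ⁻¹ _ hG
    rwa [relabel_inv_relabel] at this
  intro σ G hG
  refine ⟨fun e he => ?_, fun v => ?_⟩
  · obtain ⟨e', he', rfl⟩ := mem_relabel.1 he
    intro hd
    apply hG.1 e' he'
    induction e' using Sym2.ind with
    | h a b => simp only [Sym2.map_mk, Sym2.mk_isDiag_iff] at hd ⊢; exact σ.injective hd
  · have := filter_mem_relabel σ G (σ.symm v)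
    rw [Equiv.apply_symm_apply] at this
    rw [this, card_relabel]
    exact hG.2 _

/-- **`Ẽ` is symmetric**: `Ẽ[x_{σ·G}] = Ẽ[x_G]`. [cite: Potechin2019, Theorem 5.12 (61:12, "Ẽ_S is symmetric under permutations of [1,n]")] -/
theorem storyValue_relabel (σ : Equiv.Perm (Fin N)) (G : Finset (Sym2 (Fin N))) :
    storyValue N (relabel σ G) = storyValue N G := by
  by_cases h : IsPartialMatching G
  · rw [storyValue_of h, storyValue_of (isPartialMatching_relabel.2 h), card_relabel]
  · rw [storyValue_of_not h, storyValue_of_not (mt isPartialMatching_relabel.1 h)]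

/-- The relabelling action on coefficient indices `EdgeSets N k`, as a homomorphism
`Perm (Fin N) → Perm (EdgeSets N k)`. [cite: Potechin2019, §4 (61:10)] -/
def edgeSetsPerm (N k : ℕ) : Equiv.Perm (Fin N) →* Equiv.Perm (EdgeSets N k) where
  toFun σ :=
    { toFun := fun A => ⟨relabel σ A.1, by rw [card_relabel]; exact A.2⟩
      invFun := fun A => ⟨relabel σ⁻¹ A.1, by rw [card_relabel]; exact A.2⟩
      left_inv := fun A => Subtype.ext (relabel_inv_relabel σ A.1)
      right_inv := fun A => Subtype.ext (relabel_relabel_inv σ A.1) }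
  map_one' := by ext A : 1; exact Subtype.ext (relabel_one A.1)
  map_mul' σ τ := by ext A : 1; exact Subtype.ext (relabel_mul σ τ A.1)

/-- Unfolding of the action on coefficient indices. [cite: Potechin2019, §4 (61:10)] -/
@[simp] theorem edgeSetsPerm_apply_val (σ : Equiv.Perm (Fin N)) {k : ℕ} (A : EdgeSets N k) :
    (edgeSetsPerm N k σ A).1 = relabel σ A.1 := rfl

/-- **The pointwise stabiliser `S_{[1,n] ∖ I}`** of a vertex set `I` (the permutations fixing `I`
pointwise), as a `Finset` of permutations. [cite: Potechin2019, Theorem 4.1 (61:10, "symmetric with respect to permutations of [1,n] ∖ I")] -/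
def stab (I : Finset (Fin N)) : Finset (Equiv.Perm (Fin N)) := univ.filter fun σ => ∀ i ∈ I, σ i = i

/-- Membership in the pointwise stabiliser. [cite: Potechin2019, Theorem 4.1 (61:10)] -/
theorem mem_stab {I : Finset (Fin N)} {σ : Equiv.Perm (Fin N)} : σ ∈ stab I ↔ ∀ i ∈ I, σ i = i := by
  simp [stab]

/-- `1 ∈ stab I`. [cite: Potechin2019, Theorem 4.1 (61:10)] -/
theorem one_mem_stab (I : Finset (Fin N)) : (1 : Equiv.Perm (Fin N)) ∈ stab I := mem_stab.2 fun _ _ => rfl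

/-- `stab I` is closed under products. [cite: Potechin2019, Theorem 4.1 (61:10)] -/
theorem mul_mem_stab {I : Finset (Fin N)} {σ τ : Equiv.Perm (Fin N)} (hσ : σ ∈ stab I) (hτ : τ ∈ stab I) :
    σ * τ ∈ stab I :=
  mem_stab.2 fun i hi => by rw [Equiv.Perm.mul_apply, mem_stab.1 hτ i hi, mem_stab.1 hσ i hi]

/-- `stab I` is closed under inverses. [cite: Potechin2019, Theorem 4.1 (61:10)] -/
theorem inv_mem_stab {I : Finset (Fin N)} {σ : Equiv.Perm (Fin N)} (hσ : σ ∈ stab I) : σ⁻¹ ∈ stab I :=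
  mem_stab.2 fun i hi => by
    conv_lhs => rw [← mem_stab.1 hσ i hi]
    exact σ.symm_apply_apply i

/-- The vertex set (index set `I(p)`) of an edge set. [cite: Potechin2019, Def. 2.6 (61:5)] -/
def verts (A : Finset (Sym2 (Fin N))) : Finset (Fin N) := univ.filter fun v => ∃ e ∈ A, v ∈ e

/-- Membership in the vertex set. [cite: Potechin2019, Def. 2.6 (61:5)] -/
theorem mem_verts {A : Finset (Sym2 (Fin N))} {v : Fin N} : v ∈ verts A ↔ ∃ e ∈ A, v ∈ e := by
  simp [verts]

/-- A permutation fixing every vertex of `A` fixes `A`. [cite: Potechin2019, Def. 2.6 (61:5)] -/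
theorem relabel_eq_self_of_mem_stab {A : Finset (Sym2 (Fin N))} {σ : Equiv.Perm (Fin N)}
    (hσ : σ ∈ stab (verts A)) : relabel σ A = A := by
  have key : ∀ e ∈ A, Sym2.map σ e = e := by
    intro e he
    induction e using Sym2.ind with
    | h a b =>
      rw [Sym2.map_mk, mem_stab.1 hσ a (mem_verts.2 ⟨_, he, Sym2.mem_mk_left a b⟩),
        mem_stab.1 hσ b (mem_verts.2 ⟨_, he, Sym2.mem_mk_right a b⟩)]
  ext e
  rw [mem_relabel]
  constructor
  · rintro ⟨e', he', rfl⟩; rwa [key e' he']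
  · exact fun he => ⟨e, he, key e he⟩

/-- `|verts A| ≤ 2|A|` (a monomial of degree `k` has index degree `≤ 2k`). [cite: Potechin2019, Def. 2.6 and Remark 4.5 (61:5, 61:10)] -/
theorem card_verts_le (A : Finset (Sym2 (Fin N))) : (verts A).card ≤ 2 * A.card := by
  classical
  have : verts A ⊆ A.biUnion fun e => univ.filter fun v => v ∈ e := by
    intro v hv
    obtain ⟨e, he, hve⟩ := mem_verts.1 hv
    exact mem_biUnion.2 ⟨e, he, mem_filter.2 ⟨mem_univ _, hve⟩⟩
  refine (card_le_card this).trans ((card_biUnion_le).trans ?_)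
  rw [mul_comm, ← smul_eq_mul, ← sum_const]
  refine sum_le_sum fun e _ => ?_
  induction e using Sym2.ind with
  | h a b =>
    refine (card_le_card (show (univ.filter fun v => v ∈ s(a, b)) ⊆ {a, b} from fun v hv => ?_)).trans
      (card_le_two)
    simpa using (mem_filter.1 hv).2

/-! ### §6 The reduction for the story form -/

/-- **Reduction to stabiliser-invariant coefficient vectors.** If the story moment form is
non-negative on every coefficient vector `v` on `EdgeSets N k` that is invariant under the pointwise
stabiliser of some vertex set `I` with `|I| ≤ 2k`, then it is non-negative on all of them.
[cite: Potechin2019, Theorem 4.1 and Theorem 5.11 (61:10, 61:12)] -/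
theorem storyForm_nonneg_of_invariant {N k : ℕ}
    (h : ∀ I : Finset (Fin N), I.card ≤ 2 * k → ∀ v : EdgeSets N k → ℝ,
      (∀ σ ∈ stab I, ∀ A, v (edgeSetsPerm N k σ A) = v A) → 0 ≤ storyForm N k v)
    (δ : EdgeSets N k → ℝ) : 0 ≤ storyForm N k δ := by
  have hq : ∀ v : EdgeSets N k → ℝ, storyForm N k v = qform (fun A B => storyValue N (A.1 ∪ B.1)) v :=
    fun v => rfl
  rw [hq]
  refine qform_nonneg_of_invariant (edgeSetsPerm N k) (fun A B => storyValue N (A.1 ∪ B.1))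
    (fun A B => by rw [union_comm]) (fun σ A B => ?_) (fun A₀ => stab (verts A₀.1))
    (fun A₀ => one_mem_stab _) (fun A₀ σ hσ τ hτ => mul_mem_stab hσ hτ) (fun A₀ σ hσ => inv_mem_stab hσ)
    (fun A₀ σ hσ => Subtype.ext (relabel_eq_self_of_mem_stab hσ)) (fun A₀ v hv => ?_) δ
  · simp only [edgeSetsPerm_apply_val, ← relabel_union, storyValue_relabel]
  · rw [← hq]
    exact h (verts A₀.1) ((card_verts_le _).trans (Nat.mul_le_mul_left 2 A₀.2)) v hv

/-! ### §7 Conditioning on the outcome inside a vertex set `I` -/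

open Literature.Combinatorics.Optimization (innerEdges mem_innerEdges)

/-- **Outcome-restricted story values** `Ẽ[x_C · 1_F]`, where for `F ⊆ E(I)` the polynomial
`1_F = ∏_{e ∈ F} x_e · ∏_{e ∈ E(I) ∖ F} (1 − x_e)` is the indicator of the outcome "the matching
restricted to `I` is exactly `F`", expanded by inclusion–exclusion:
`Ẽ[x_C 1_F] = Σ_{S ⊆ E(I) ∖ F} (−1)^{|S|} Ẽ[x_{C ∪ F ∪ S}]`.
[cite: Potechin2019, §3.1 and Def. 5.2 (61:7, 61:11: "the adversary specifies what happened with the indices in A")] -/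
def outcomeValue (N : ℕ) (I : Finset (Fin N)) (F C : Finset (Sym2 (Fin N))) : ℝ :=
  ∑ S ∈ (innerEdges I \ F).powerset, (-1 : ℝ) ^ S.card * storyValue N (C ∪ F ∪ S)

/-- **Partition of unity over outcomes**: `Σ_{F ⊆ E(I)} Ẽ[x_C 1_F] = Ẽ[x_C]`
(the outcomes inside `I` exhaust all cases: `Σ_F 1_F = 1`).
[cite: Potechin2019, Def. 5.2 (61:11, "Σ_j p_{ij} = 1")] -/
theorem sum_outcomeValue (N : ℕ) (I : Finset (Fin N)) (C : Finset (Sym2 (Fin N))) :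
    ∑ F ∈ (innerEdges I).powerset, outcomeValue N I F C = storyValue N C := by
  classical
  set E := innerEdges I
  -- reindex the double sum by `T = F ∪ S`
  have h1 : ∑ F ∈ E.powerset, outcomeValue N I F C =
      ∑ T ∈ E.powerset, (∑ F ∈ T.powerset, (-1 : ℝ) ^ (T \ F).card) * storyValue N (C ∪ T) := by
    simp only [outcomeValue, sum_mul]
    rw [sum_sigma' E.powerset fun F => (E \ F).powerset, sum_sigma' E.powerset fun T => T.powerset]
    refine sum_nbij' (fun p => ⟨p.1 ∪ p.2, p.1⟩) (fun p => ⟨p.2, p.1 \ p.2⟩) ?_ ?_ ?_ ?_ ?_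
    · rintro ⟨F, S⟩ hp
      simp only [mem_sigma, mem_powerset] at hp ⊢
      exact ⟨union_subset hp.1 (hp.2.trans sdiff_subset), subset_union_left⟩
    · rintro ⟨T, F⟩ hp
      simp only [mem_sigma, mem_powerset] at hp ⊢
      exact ⟨hp.2.trans hp.1, sdiff_subset_sdiff hp.1 subset_rfl⟩
    · rintro ⟨F, S⟩ hp
      simp only [mem_sigma, mem_powerset] at hp
      have hd : Disjoint F S := disjoint_of_subset_right hp.2 disjoint_sdiff
      simp only [union_sdiff_left, Finset.sdiff_eq_self_iff_disjoint.2 hd.symm]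
    · rintro ⟨T, F⟩ hp
      simp only [mem_sigma, mem_powerset] at hp
      simp only [union_sdiff_of_subset hp.2]
    · rintro ⟨F, S⟩ hp
      simp only [mem_sigma, mem_powerset] at hp
      have hd : Disjoint F S := disjoint_of_subset_right hp.2 disjoint_sdiff
      simp only [union_sdiff_left, Finset.sdiff_eq_self_iff_disjoint.2 hd.symm, union_assoc]
  rw [h1]
  -- the inner alternating sum is `[T = ∅]`
  have h2 : ∀ T : Finset (Sym2 (Fin N)), ∑ F ∈ T.powerset, (-1 : ℝ) ^ (T \ F).card = if T = ∅ then 1 else 0 := by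
    intro T
    have := (sum_powerset_neg_one_pow_card (x := T))
    have h' : ∑ F ∈ T.powerset, (-1 : ℝ) ^ (T \ F).card = ∑ F ∈ T.powerset, (-1 : ℝ) ^ F.card := by
      refine sum_nbij' (fun F => T \ F) (fun F => T \ F) (fun F hF => mem_powerset.2 sdiff_subset)
        (fun F hF => mem_powerset.2 sdiff_subset) (fun F hF => ?_) (fun F hF => ?_) (fun F hF => rfl)
      · exact Finset.sdiff_sdiff_eq_self (mem_powerset.1 hF)
      · exact Finset.sdiff_sdiff_eq_self (mem_powerset.1 hF)
    rw [h']
    have := congrArg (fun z : ℤ => (z : ℝ)) this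
    push_cast at this
    rw [this]
  simp only [h2, ite_mul, one_mul, zero_mul, sum_ite_eq', mem_powerset, empty_subset, if_true, union_empty]

end PseudoMatching

end Literature.Computability.Complexity
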